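import Literature.MathematicalPhysics.QuantumLattice.HubbardRingExchangeDictionary
import Mathlib.Analysis.SpecialFunctions.Trigonometric.Basic

/-!
# Linear-spin-wave zone-boundary identities of the square-lattice `J–J′–J″–J_c` model (the observables of the cuprate «t–U fits»)

Companion to `HubbardRingExchangeDictionary.lean`.  The magnon dispersion used to fit the
inelastic-neutron / RIXS data of cuprate parents is the classical (large-`S`) linear-spin-wave
dispersion of the Heisenberg model with first-, second-, third-neighbour couplings `J, J′, J″` and
ring exchange `J_c` [ColdeaEtAl2001, p. 3]:
`ω_Q = 2 Z_c(Q) √(A_Q² − B_Q²)`,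
`A_Q = J − J_c/2 − (J′ − J_c/4)(1 − ν_h ν_k) − J″[1 − (ν_{2h} + ν_{2k})/2]`,
`B_Q = (J − J_c/2)(ν_h + ν_k)/2`, `ν_x = cos(2πx)`, `Q = (h, k)` in reciprocal-lattice units,
with `Z_c` a quantum renormalisation factor (taken wavevector-independent, `Z_c = 1.18`, in the fits).

Here the dispersion is a DEFINITION (`lswtA`, `lswtB`, `lswtOmega`; `Z_c` is a free parameter,
never evaluated) and the theorems are its exact evaluations at the high-symmetry points that the
papers quote:

* `B = 0` on the zone boundary points `(1/2, 0)` and `(1/4, 1/4)`, with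
  `A(1/2,0) = J − 2J′` and `A(1/4,1/4) = J − J′ − 2J″ − J_c/4`, hence
  `ω(1/2,0) = 2Z_c|J − 2J′|`, `ω(1/4,1/4) = 2Z_c|J − J′ − 2J″ − J_c/4|`;
* the Goldstone zeros `ω(0,0) = ω(1/2,1/2) = 0`;
* in the one-band-Hubbard parametrisation `J′ = J″ = J_c/20` (file 1):
  `E_max = ω(1/2,0) = 2Z_c(J − J_c/10)` and the zone-boundary dispersion
  `ΔE_MBZB = ω(1/2,0) − ω(1/4,1/4) = (3/5) Z_c J_c` [PengEtAl2017, Eqs. (1)–(2)] — «`E_max` is mainly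
  set by `J`, whereas `J_c` determines the dispersion along the zone boundary» — and conversely
  `J_c = 5ΔE_MBZB/(3Z_c)`, `J = E_max/(2Z_c) + ΔE_MBZB/(6Z_c)`;
* the same two observables in `(t, U)`: `E_max = 2Z_c(4t²/U − 32t⁴/U³)`,
  `ΔE_MBZB = 48 Z_c t⁴/U³`, and Coldea's one-spin-flip energy `2(J − J_c/4 − J′ − J″) = 8t²/U − 104t⁴/U³`
  [ColdeaEtAl2001, p. 3].

* §7 (appended): the four combinations quoted as «J» — `J`, `E_max/2Z_c = J − J_c/10`,
  Dalla Piazza's `J_NN = ω(π/2,π/2)/2Z_c = J − 2J_c/5` [DallapiazzaEtAl2012], Ivashko's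
  `J_eff = J − J_c/2 = 4t²/U − 64t⁴/U³ = A(0,0)` [IvashkoEtAl2019, Eq. (6)] — and their ordering.
* §8 (appended): the `Z_c` CONVENTION identity — `ω(Z_c; cJ, cJ′, cJ″, cJ_c) = ω(cZ_c; J, J′, J″, J_c)`
  (`c ≥ 0`): a dispersion identifies only `Z_cJ, Z_cJ′, Z_cJ″, Z_cJ_c`; `Z_c = 1.18` values [Tranquada2007,
  Table 8.1] times `1.18` are the `Z_c = 1` values; coupling ratios are convention-free.

Not here: the spin-wave derivation itself, intensities, the `1/S` corrections inside `Z_c`, or any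
statement that a measured `(E_max, ΔE_MBZB)` pair obeys these identities (the printed `J, J_c` are
least-squares fits to whole dispersions).

References: R. Coldea et al., Phys. Rev. Lett. 86 (2001) 5377, arXiv:cond-mat/0006384, p. 3;
Y. Y. Peng et al., Nature Phys. 13 (2017) 1201, arXiv:1609.05405, Eqs. (1)–(2); J. M. Tranquada, in
*Handbook of High-Temperature Superconductivity* (Springer, 2007), arXiv:cond-mat/0512115, Table 8.1.
AI-produced formalisation (H21, cell hubbard-downfold, seat lit-2, 2026-08-27); no facts, no
axioms beyond Mathlib's, no `sorry`.
-/

namespace Literature.MathematicalPhysics.QuantumLattice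

open Real

noncomputable section

/-! ## 1. The printed dispersion -/

/-- `ν_x = cos(2πx)` (wavevector component `x` in reciprocal-lattice units).
[cite: ColdeaEtAl2001, p. 3] -/
def lswtNu (x : ℝ) : ℝ := cos (2 * π * x)

/-- `A_Q = J − J_c/2 − (J′ − J_c/4)(1 − ν_h ν_k) − J″[1 − (ν_{2h} + ν_{2k})/2]`.
[cite: ColdeaEtAl2001, p. 3] -/
def lswtA (J J₂ J₃ Jc h k : ℝ) : ℝ :=
  J - Jc / 2 - (J₂ - Jc / 4) * (1 - lswtNu h * lswtNu k) -
    J₃ * (1 - (lswtNu (2 * h) + lswtNu (2 * k)) / 2)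

/-- `B_Q = (J − J_c/2)(ν_h + ν_k)/2`. [cite: ColdeaEtAl2001, p. 3] -/
def lswtB (J Jc h k : ℝ) : ℝ := (J - Jc / 2) * (lswtNu h + lswtNu k) / 2

/-- The linear-spin-wave magnon energy `ω_Q = 2 Z_c √(A_Q² − B_Q²)` (with `√` of a negative
argument `= 0`, Lean's convention, irrelevant at the points evaluated here).
[cite: ColdeaEtAl2001, p. 3] -/
def lswtOmega (Zc J J₂ J₃ Jc h k : ℝ) : ℝ :=
  2 * Zc * sqrt (lswtA J J₂ J₃ Jc h k ^ 2 - lswtB J Jc h k ^ 2)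

/-- Unfolding. [cite: ColdeaEtAl2001, p. 3] -/
theorem lswtNu_def (x : ℝ) : lswtNu x = cos (2 * π * x) := rfl

/-- Unfolding. [cite: ColdeaEtAl2001, p. 3] -/
theorem lswtA_def (J J₂ J₃ Jc h k : ℝ) : lswtA J J₂ J₃ Jc h k =
    J - Jc / 2 - (J₂ - Jc / 4) * (1 - lswtNu h * lswtNu k) -
      J₃ * (1 - (lswtNu (2 * h) + lswtNu (2 * k)) / 2) := rfl

/-- Unfolding. [cite: ColdeaEtAl2001, p. 3] -/
theorem lswtB_def (J Jc h k : ℝ) : lswtB J Jc h k = (J - Jc / 2) * (lswtNu h + lswtNu k) / 2 := rfl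

/-- Unfolding. [cite: ColdeaEtAl2001, p. 3] -/
theorem lswtOmega_def (Zc J J₂ J₃ Jc h k : ℝ) : lswtOmega Zc J J₂ J₃ Jc h k =
    2 * Zc * sqrt (lswtA J J₂ J₃ Jc h k ^ 2 - lswtB J Jc h k ^ 2) := rfl

/-! ## 2. Values of `ν` at the high-symmetry coordinates -/

/-- `ν_0 = 1`. [cite: ColdeaEtAl2001, p. 3] -/
theorem lswtNu_zero : lswtNu 0 = 1 := by simp [lswtNu]

/-- `ν_{1/2} = cos π = −1`. [cite: ColdeaEtAl2001, p. 3] -/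
theorem lswtNu_half : lswtNu (1 / 2) = -1 := by
  unfold lswtNu; rw [show (2 : ℝ) * π * (1 / 2) = π by ring]; exact cos_pi

/-- `ν_{1/4} = cos(π/2) = 0`. [cite: ColdeaEtAl2001, p. 3] -/
theorem lswtNu_quarter : lswtNu (1 / 4) = 0 := by
  unfold lswtNu; rw [show (2 : ℝ) * π * (1 / 4) = π / 2 by ring]; exact cos_pi_div_two

/-- `ν_1 = cos 2π = 1`. [cite: ColdeaEtAl2001, p. 3] -/
theorem lswtNu_one : lswtNu 1 = 1 := by
  unfold lswtNu; rw [mul_one]; exact cos_two_pi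

/-- `ν` is even. [cite: ColdeaEtAl2001, p. 3] -/
theorem lswtNu_neg (x : ℝ) : lswtNu (-x) = lswtNu x := by
  unfold lswtNu; rw [mul_neg, cos_neg]

/-- `ν` has period `1` (reciprocal-lattice periodicity). [cite: ColdeaEtAl2001, p. 3] -/
theorem lswtNu_add_one (x : ℝ) : lswtNu (x + 1) = lswtNu x := by
  unfold lswtNu; rw [mul_add, mul_one, cos_add_two_pi]

/-! ## 3. The zone-boundary points `(1/2, 0)` and `(1/4, 1/4)` -/

/-- `A(1/2, 0) = J − 2J′`. [cite: ColdeaEtAl2001, p. 3] -/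
theorem lswtA_half_zero (J J₂ J₃ Jc : ℝ) : lswtA J J₂ J₃ Jc (1 / 2) 0 = J - 2 * J₂ := by
  unfold lswtA
  rw [show (2 : ℝ) * (1 / 2) = 1 by norm_num, mul_zero, lswtNu_half, lswtNu_zero, lswtNu_one]
  ring

/-- `B(1/2, 0) = 0`. [cite: ColdeaEtAl2001, p. 3] -/
theorem lswtB_half_zero (J Jc : ℝ) : lswtB J Jc (1 / 2) 0 = 0 := by
  unfold lswtB; rw [lswtNu_half, lswtNu_zero]; ring

/-- `ω(1/2, 0) = 2Z_c |J − 2J′|`. [cite: ColdeaEtAl2001, p. 3] -/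
theorem lswtOmega_half_zero (Zc J J₂ J₃ Jc : ℝ) :
    lswtOmega Zc J J₂ J₃ Jc (1 / 2) 0 = 2 * Zc * |J - 2 * J₂| := by
  unfold lswtOmega
  rw [lswtA_half_zero, lswtB_half_zero, zero_pow two_ne_zero, sub_zero, sqrt_sq_eq_abs]

/-- `A(1/4, 1/4) = J − J′ − 2J″ − J_c/4`. [cite: ColdeaEtAl2001, p. 3] -/
theorem lswtA_quarter_quarter (J J₂ J₃ Jc : ℝ) :
    lswtA J J₂ J₃ Jc (1 / 4) (1 / 4) = J - J₂ - 2 * J₃ - Jc / 4 := by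
  unfold lswtA
  rw [show (2 : ℝ) * (1 / 4) = 1 / 2 by norm_num, lswtNu_quarter, lswtNu_half]
  ring

/-- `B(1/4, 1/4) = 0`. [cite: ColdeaEtAl2001, p. 3] -/
theorem lswtB_quarter_quarter (J Jc : ℝ) : lswtB J Jc (1 / 4) (1 / 4) = 0 := by
  unfold lswtB; rw [lswtNu_quarter]; ring

/-- `ω(1/4, 1/4) = 2Z_c |J − J′ − 2J″ − J_c/4|`. [cite: ColdeaEtAl2001, p. 3] -/
theorem lswtOmega_quarter_quarter (Zc J J₂ J₃ Jc : ℝ) :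
    lswtOmega Zc J J₂ J₃ Jc (1 / 4) (1 / 4) = 2 * Zc * |J - J₂ - 2 * J₃ - Jc / 4| := by
  unfold lswtOmega
  rw [lswtA_quarter_quarter, lswtB_quarter_quarter, zero_pow two_ne_zero, sub_zero, sqrt_sq_eq_abs]

/-! ## 4. Goldstone zeros at `(0, 0)` and `(1/2, 1/2)` -/

/-- `A(0,0) = B(0,0) = J − J_c/2`. [cite: ColdeaEtAl2001, p. 3] -/
theorem lswtA_zero_zero (J J₂ J₃ Jc : ℝ) : lswtA J J₂ J₃ Jc 0 0 = J - Jc / 2 := by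
  unfold lswtA; rw [mul_zero, lswtNu_zero]; ring

/-- `B(0,0) = J − J_c/2`. [cite: ColdeaEtAl2001, p. 3] -/
theorem lswtB_zero_zero (J Jc : ℝ) : lswtB J Jc 0 0 = J - Jc / 2 := by
  unfold lswtB; rw [lswtNu_zero]; ring

/-- `ω(0, 0) = 0` (Goldstone mode at the zone centre). [cite: ColdeaEtAl2001, p. 3] -/
theorem lswtOmega_zero_zero (Zc J J₂ J₃ Jc : ℝ) : lswtOmega Zc J J₂ J₃ Jc 0 0 = 0 := by
  unfold lswtOmega; rw [lswtA_zero_zero, lswtB_zero_zero, sub_self, sqrt_zero, mul_zero]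

/-- `A(1/2,1/2) = J − J_c/2`. [cite: ColdeaEtAl2001, p. 3] -/
theorem lswtA_half_half (J J₂ J₃ Jc : ℝ) : lswtA J J₂ J₃ Jc (1 / 2) (1 / 2) = J - Jc / 2 := by
  unfold lswtA
  rw [show (2 : ℝ) * (1 / 2) = 1 by norm_num, lswtNu_half, lswtNu_one]
  ring

/-- `B(1/2,1/2) = −(J − J_c/2)`. [cite: ColdeaEtAl2001, p. 3] -/
theorem lswtB_half_half (J Jc : ℝ) : lswtB J Jc (1 / 2) (1 / 2) = -(J - Jc / 2) := by
  unfold lswtB; rw [lswtNu_half]; ring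

/-- `ω(1/2, 1/2) = 0` (Goldstone mode at the antiferromagnetic zone centre).
[cite: ColdeaEtAl2001, p. 3] -/
theorem lswtOmega_half_half (Zc J J₂ J₃ Jc : ℝ) : lswtOmega Zc J J₂ J₃ Jc (1 / 2) (1 / 2) = 0 := by
  unfold lswtOmega; rw [lswtA_half_half, lswtB_half_half, neg_sq, sub_self, sqrt_zero, mul_zero]

/-! ## 5. The one-band-Hubbard parametrisation `J′ = J″ = J_c/20` (Peng et al. Eqs. (1)–(2)) -/

/-- `E_max = ω(1/2, 0) = 2Z_c(J − J_c/10)` when `J′ = J″ = J_c/20` and `J_c ≤ 10J`.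
[cite: PengEtAl2017, Eq. (1)] -/
theorem lswtOmega_half_zero_hubbard {J Jc : ℝ} (Zc : ℝ) (h : Jc ≤ 10 * J) :
    lswtOmega Zc J (Jc / 20) (Jc / 20) Jc (1 / 2) 0 = 2 * Zc * (J - Jc / 10) := by
  rw [lswtOmega_half_zero, show J - 2 * (Jc / 20) = J - Jc / 10 by ring,
    abs_of_nonneg (by linarith)]

/-- `ω(1/4, 1/4) = 2Z_c(J − 2J_c/5)` when `J′ = J″ = J_c/20` and `2J_c ≤ 5J`.
[cite: PengEtAl2017, Eq. (2)] -/
theorem lswtOmega_quarter_quarter_hubbard {J Jc : ℝ} (Zc : ℝ) (h : 2 * Jc ≤ 5 * J) :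
    lswtOmega Zc J (Jc / 20) (Jc / 20) Jc (1 / 4) (1 / 4) = 2 * Zc * (J - 2 * Jc / 5) := by
  rw [lswtOmega_quarter_quarter, show J - Jc / 20 - 2 * (Jc / 20) - Jc / 4 = J - 2 * Jc / 5 by ring,
    abs_of_nonneg (by linarith)]

/-- **Zone-boundary dispersion** `ΔE_MBZB = ω(1/2,0) − ω(1/4,1/4) = (3/5) Z_c J_c` when
`J′ = J″ = J_c/20`, `0 ≤ J_c`, `2J_c ≤ 5J` — «`J_c` determines the dispersion along the zone
boundary». [cite: PengEtAl2017, Eq. (2)] -/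
theorem lswt_zoneBoundaryDispersion {J Jc : ℝ} (Zc : ℝ) (hJc : 0 ≤ Jc) (h : 2 * Jc ≤ 5 * J) :
    lswtOmega Zc J (Jc / 20) (Jc / 20) Jc (1 / 2) 0 -
      lswtOmega Zc J (Jc / 20) (Jc / 20) Jc (1 / 4) (1 / 4) = 3 / 5 * Zc * Jc := by
  rw [lswtOmega_half_zero_hubbard Zc (by linarith), lswtOmega_quarter_quarter_hubbard Zc h]; ring

/-- Reading the couplings off the two observables: `E_max = 2Z_c(J − J_c/10)` and
`ΔE = (3/5)Z_cJ_c` give `J_c = 5ΔE/(3Z_c)` and `J = E_max/(2Z_c) + ΔE/(6Z_c)` (`Z_c ≠ 0`).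
[cite: PengEtAl2017, Eqs. (1)–(2)] -/
theorem couplings_of_observables {Zc J Jc Emax ΔE : ℝ} (hZ : Zc ≠ 0)
    (hE : Emax = 2 * Zc * (J - Jc / 10)) (hΔ : ΔE = 3 / 5 * Zc * Jc) :
    Jc = 5 * ΔE / (3 * Zc) ∧ J = Emax / (2 * Zc) + ΔE / (6 * Zc) := by
  subst hE hΔ
  constructor
  · field_simp
  · field_simp; ring

/-! ## 6. The same observables in the Hubbard variables `(t, U)` -/

/-- `J − J_c/10 = 4t²/U − 32t⁴/U³`. [cite: PengEtAl2017, Eq. (1)] -/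
theorem scJ1_sub_scJc_div_ten (t U : ℝ) : scJ1 t U - scJc t U / 10 = 4 * t ^ 2 / U - 32 * t ^ 4 / U ^ 3 := by
  unfold scJ1 scJc; ring

/-- `J − 2J_c/5 = 4t²/U − 56t⁴/U³`. [cite: PengEtAl2017, Eq. (2)] -/
theorem scJ1_sub_two_scJc_div_five (t U : ℝ) :
    scJ1 t U - 2 * scJc t U / 5 = 4 * t ^ 2 / U - 56 * t ^ 4 / U ^ 3 := by
  unfold scJ1 scJc; ring

/-- The domain condition `J_c ≤ 10J` reads `8t² ≤ U²` (for `U > 0`). [cite: PengEtAl2017, Eq. (1)] -/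
theorem scJc_le_ten_scJ1_iff {t U : ℝ} (hU : 0 < U) : scJc t U ≤ 10 * scJ1 t U ↔ 8 * t ^ 4 ≤ t ^ 2 * U ^ 2 := by
  unfold scJ1 scJc
  have hU3 : 0 < U ^ 3 := by positivity
  constructor
  · intro h
    have h' : 80 * t ^ 4 / U ^ 3 * U ^ 3 ≤ 10 * (4 * t ^ 2 / U - 24 * t ^ 4 / U ^ 3) * U ^ 3 :=
      mul_le_mul_of_nonneg_right h hU3.le
    field_simp at h'
    nlinarith [h']
  · intro h
    rw [← sub_nonneg]
    have : 10 * (4 * t ^ 2 / U - 24 * t ^ 4 / U ^ 3) - 80 * t ^ 4 / U ^ 3 =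
        40 * (t ^ 2 * U ^ 2 - 8 * t ^ 4) / U ^ 3 := by
      field_simp; ring
    rw [this]
    exact div_nonneg (by linarith) hU3.le

/-- `E_max = ω(1/2,0) = 2Z_c(4t²/U − 32t⁴/U³)` in the Hubbard parametrisation (for `U > 0`,
`8t² ≤ U²`). [cite: PengEtAl2017, Eq. (1)] -/
theorem lswt_Emax_tU {t U : ℝ} (Zc : ℝ) (hU : 0 < U) (h : 8 * t ^ 2 ≤ U ^ 2) :
    lswtOmega Zc (scJ1 t U) (scJ2 t U) (scJ2 t U) (scJc t U) (1 / 2) 0 =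
      2 * Zc * (4 * t ^ 2 / U - 32 * t ^ 4 / U ^ 3) := by
  rw [scJ2_eq_scJc_div, ← scJ1_sub_scJc_div_ten]
  refine lswtOmega_half_zero_hubbard Zc ((scJc_le_ten_scJ1_iff hU).mpr ?_)
  nlinarith [sq_nonneg t]

/-- **`ΔE_MBZB = 48 Z_c t⁴/U³`** in the Hubbard parametrisation (for `U > 0`, `14t² ≤ U²`):
the zone-boundary dispersion measures `t⁴/U³`. [cite: PengEtAl2017, Eq. (2)] -/
theorem lswt_zoneBoundaryDispersion_tU {t U : ℝ} (Zc : ℝ) (hU : 0 < U) (h : 14 * t ^ 2 ≤ U ^ 2) :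
    lswtOmega Zc (scJ1 t U) (scJ2 t U) (scJ2 t U) (scJc t U) (1 / 2) 0 -
      lswtOmega Zc (scJ1 t U) (scJ2 t U) (scJ2 t U) (scJc t U) (1 / 4) (1 / 4) =
        48 * Zc * t ^ 4 / U ^ 3 := by
  rw [scJ2_eq_scJc_div]
  have hJc : 0 ≤ scJc t U := by unfold scJc; positivity
  have hdom : 2 * scJc t U ≤ 5 * scJ1 t U := by
    rw [← sub_nonneg]
    have : 5 * scJ1 t U - 2 * scJc t U = 20 * (t ^ 2 * U ^ 2 - 14 * t ^ 4) / U ^ 3 := by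
      unfold scJ1 scJc; field_simp; ring
    rw [this]
    exact div_nonneg (by nlinarith [sq_nonneg t]) (by positivity)
  rw [lswt_zoneBoundaryDispersion Zc hJc hdom]
  unfold scJc; ring

/-- Coldea's one-spin-flip energy on the Néel state, `2(J − J_c/4 − J′ − J″)`, in the Hubbard
variables: `8t²/U − 104t⁴/U³`. [cite: ColdeaEtAl2001, p. 3] -/
theorem spinFlipEnergy_tU (t U : ℝ) :
    2 * (scJ1 t U - scJc t U / 4 - scJ2 t U - scJ2 t U) = 8 * t ^ 2 / U - 104 * t ^ 4 / U ^ 3 := by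
  unfold scJ1 scJ2 scJc; ring

/-! ## 7. Which «J»? Four distinct combinations of the same `(t, U)` that the literature calls `J`

(Appended 2026-08-27, seat lit-2.)  Besides the nearest-neighbour coupling
`J = 4t²/U − 24t⁴/U³` (`scJ1`) and `E_max/(2Z_c) = J − J_c/10 = 4t²/U − 32t⁴/U³`
(`lswt_Emax_tU`), two more combinations are quoted as «J» in the fitting papers:
Dalla Piazza et al. define `J_NN := ω(π/2, π/2)/(2Z_c)` [DallapiazzaEtAl2012, p. 2], which in
the `t`-only fourth-order model is `J − 2J_c/5 = 4t²/U − 56t⁴/U³`; Ivashko et al. map the Hubbard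
model onto a Heisenberg `J_eff = 4t²/U − 64t⁴/U³` [IvashkoEtAl2019, Methods Eq. (6)], which is
`J − J_c/2 = A(0,0) = B(0,0)`, the long-wavelength coefficient of the dispersion (§4).  The four
differ by up to `40 t⁴/U³` — e.g. `142.8 / 137.0 / 119.7 / 113.9` meV at Headings' La₂CuO₄ point
(`t = 298`, `U = 2218` meV) — so a quoted «J [meV]» must say which object it is. -/

/-- `J − J_c/2 = 4t²/U − 64t⁴/U³` — Ivashko et al.'s `J_eff` (their Eq. (6)) is this combination
of the fourth-order couplings. [cite: IvashkoEtAl2019, Methods Eq. (6)] -/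
theorem scJ1_sub_scJc_div_two (t U : ℝ) :
    scJ1 t U - scJc t U / 2 = 4 * t ^ 2 / U - 64 * t ^ 4 / U ^ 3 := by
  unfold scJ1 scJc; ring

/-- In the Hubbard parametrisation the long-wavelength LSWT coefficient `A(0,0)` (`= B(0,0)`,
§4) equals Ivashko et al.'s `J_eff = 4t²/U − 64t⁴/U³`. [cite: IvashkoEtAl2019, Methods Eq. (6)] -/
theorem lswtA_zero_zero_tU (t U : ℝ) :
    lswtA (scJ1 t U) (scJ2 t U) (scJ2 t U) (scJc t U) 0 0 = 4 * t ^ 2 / U - 64 * t ^ 4 / U ^ 3 := by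
  rw [lswtA_zero_zero, scJ1_sub_scJc_div_two]

/-- `B(0,0)` likewise equals `4t²/U − 64t⁴/U³` in the Hubbard parametrisation.
[cite: IvashkoEtAl2019, Methods Eq. (6)] -/
theorem lswtB_zero_zero_tU (t U : ℝ) :
    lswtB (scJ1 t U) (scJc t U) 0 0 = 4 * t ^ 2 / U - 64 * t ^ 4 / U ^ 3 := by
  rw [lswtB_zero_zero, scJ1_sub_scJc_div_two]

/-- Dalla Piazza et al.'s `J_NN := ω(π/2,π/2)/(2Z_c)`: in the `t`-only fourth-order model
(`J′ = J″ = J_c/20`), for `U > 0` and `14t² ≤ U²`, `ω(1/4,1/4) = 2Z_c(4t²/U − 56t⁴/U³)`, i.e.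
`J_NN = J − 2J_c/5 = 4t²/U − 56t⁴/U³`. [cite: DallapiazzaEtAl2012, p. 2] -/
theorem lswtOmega_quarter_quarter_tU {t U : ℝ} (Zc : ℝ) (hU : 0 < U) (h : 14 * t ^ 2 ≤ U ^ 2) :
    lswtOmega Zc (scJ1 t U) (scJ2 t U) (scJ2 t U) (scJc t U) (1 / 4) (1 / 4) =
      2 * Zc * (4 * t ^ 2 / U - 56 * t ^ 4 / U ^ 3) := by
  rw [scJ2_eq_scJc_div, ← scJ1_sub_two_scJc_div_five]
  have hdom : 2 * scJc t U ≤ 5 * scJ1 t U := by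
    rw [← sub_nonneg]
    have : 5 * scJ1 t U - 2 * scJc t U = 20 * (t ^ 2 * U ^ 2 - 14 * t ^ 4) / U ^ 3 := by
      unfold scJ1 scJc; field_simp; ring
    rw [this]
    exact div_nonneg (by nlinarith [sq_nonneg t]) (by positivity)
  exact lswtOmega_quarter_quarter_hubbard Zc hdom

/-- The four «J» objects are ordered `J_eff ≤ J_NN ≤ E_max/(2Z_c) ≤ J` for `U > 0`
(differences `8, 24, 8 × t⁴/U³ ≥ 0`). [cite: IvashkoEtAl2019, Methods Eq. (6)] -/
theorem fourJ_chain {t U : ℝ} (hU : 0 < U) :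
    4 * t ^ 2 / U - 64 * t ^ 4 / U ^ 3 ≤ 4 * t ^ 2 / U - 56 * t ^ 4 / U ^ 3 ∧
      4 * t ^ 2 / U - 56 * t ^ 4 / U ^ 3 ≤ 4 * t ^ 2 / U - 32 * t ^ 4 / U ^ 3 ∧
        4 * t ^ 2 / U - 32 * t ^ 4 / U ^ 3 ≤ scJ1 t U := by
  have h0 : 0 ≤ t ^ 4 / U ^ 3 := by positivity
  unfold scJ1
  refine ⟨?_, ?_, ?_⟩
  · have : 4 * t ^ 2 / U - 56 * t ^ 4 / U ^ 3 - (4 * t ^ 2 / U - 64 * t ^ 4 / U ^ 3)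
        = 8 * (t ^ 4 / U ^ 3) := by ring
    linarith
  · have : 4 * t ^ 2 / U - 32 * t ^ 4 / U ^ 3 - (4 * t ^ 2 / U - 56 * t ^ 4 / U ^ 3)
        = 24 * (t ^ 4 / U ^ 3) := by ring
    linarith
  · have : 4 * t ^ 2 / U - 24 * t ^ 4 / U ^ 3 - (4 * t ^ 2 / U - 32 * t ^ 4 / U ^ 3)
        = 8 * (t ^ 4 / U ^ 3) := by ring
    linarith

/-- Worked instance (Headings' La₂CuO₄ point, `t = 298`, `U = 2218` meV): the four objects
evaluate inside `(113.8, 114.0)`, `(119.6, 119.8)`, `(137.0, 137.2)`, `(142.8, 143.0)` meV.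
[cite: HeadingsEtAl2010, p. 3] -/
theorem fourJ_headings2010 :
    113.8 < 4 * (298:ℝ) ^ 2 / 2218 - 64 * (298:ℝ) ^ 4 / 2218 ^ 3 ∧
      4 * (298:ℝ) ^ 2 / 2218 - 64 * (298:ℝ) ^ 4 / 2218 ^ 3 < 114.0 ∧
    119.6 < 4 * (298:ℝ) ^ 2 / 2218 - 56 * (298:ℝ) ^ 4 / 2218 ^ 3 ∧
      4 * (298:ℝ) ^ 2 / 2218 - 56 * (298:ℝ) ^ 4 / 2218 ^ 3 < 119.8 ∧
    137.0 < 4 * (298:ℝ) ^ 2 / 2218 - 32 * (298:ℝ) ^ 4 / 2218 ^ 3 ∧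
      4 * (298:ℝ) ^ 2 / 2218 - 32 * (298:ℝ) ^ 4 / 2218 ^ 3 < 137.2 ∧
    142.8 < scJ1 298 2218 ∧ scJ1 298 2218 < 143.0 := by
  unfold scJ1; norm_num


/-! ## 8. The `Z_c` CONVENTION identity of the single-layer dispersion (appended)

The dispersion is homogeneous of degree one in the couplings, so a fit with renormalisation factor
`Z_c` and couplings `(J, J′, J″, J_c)` and a fit with `Z_c = 1` and couplings
`(Z_cJ, Z_cJ′, Z_cJ″, Z_cJ_c)` are the SAME curve: only the products `Z_cJ, …` are identified by a
dispersion, and a value quoted «with `Z_c = 1.18`» [ColdeaEtAl2001, p. 3; Tranquada2007, Table 8.1]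
converts to the nearest-neighbour-only `Z_c = 1` convention by multiplication with `1.18`
(e.g. `106 ↦ 125.08`, `146.3 ↦ 172.6`); ratios such as `J_c/J` are convention-free (the one-line
statement is `jperp_ratio_convention` of `BilayerSpinWaves.lean`, which imports this file). -/

/-- `A_Q` is linear in the couplings: `A(cJ, cJ′, cJ″, cJ_c) = c·A(J, J′, J″, J_c)`.
[cite: ColdeaEtAl2001, p. 3] -/
theorem lswtA_smul (c J J₂ J₃ Jc h k : ℝ) :
    lswtA (c * J) (c * J₂) (c * J₃) (c * Jc) h k = c * lswtA J J₂ J₃ Jc h k := by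
  simp only [lswtA]; ring

/-- `B_Q` is linear in the couplings. [cite: ColdeaEtAl2001, p. 3] -/
theorem lswtB_smul (c J Jc h k : ℝ) : lswtB (c * J) (c * Jc) h k = c * lswtB J Jc h k := by
  simp only [lswtB]; ring

/-- **Convention identity**: for `c ≥ 0`, `ω(Z_c; cJ, cJ′, cJ″, cJ_c) = ω(cZ_c; J, J′, J″, J_c)` at
every wavevector — scaling all couplings by `c` is the same as scaling `Z_c` by `c`.
[cite: ColdeaEtAl2001, p. 3] -/
theorem lswtOmega_convention {c : ℝ} (Zc J J₂ J₃ Jc h k : ℝ) (hc : 0 ≤ c) :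
    lswtOmega Zc (c * J) (c * J₂) (c * J₃) (c * Jc) h k = lswtOmega (c * Zc) J J₂ J₃ Jc h k := by
  rw [lswtOmega, lswtOmega, lswtA_smul, lswtB_smul, mul_pow, mul_pow, ← mul_sub,
    sqrt_mul (sq_nonneg c), sqrt_sq hc]
  ring

/-- In particular a `Z_c = 1` fit with couplings `Z_c·(J, J′, J″, J_c)` reproduces the `Z_c` fit
(`Z_c ≥ 0`): the dispersion identifies only the products. [cite: ColdeaEtAl2001, p. 3] -/
theorem lswtOmega_convention_one {Zc : ℝ} (J J₂ J₃ Jc h k : ℝ) (hZ : 0 ≤ Zc) :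
    lswtOmega 1 (Zc * J) (Zc * J₂) (Zc * J₃) (Zc * Jc) h k = lswtOmega Zc J J₂ J₃ Jc h k := by
  rw [lswtOmega_convention 1 J J₂ J₃ Jc h k hZ, mul_one]

/-- The conversion numbers: the review's `J = 106 meV` (YBa₂Cu₃O₆.₁) and `146.3 meV` (La₂CuO₄,
Coldea 10 K), both «with `Z_c = 1.18`», read `125.08` and `172.634` meV in the `Z_c = 1` convention;
conversely a `Z_c = 1` value `125` reads `125/1.18 ∈ (105.9, 106)`. [cite: Tranquada2007, Table 8.1] -/
theorem zc_conversion_numbers :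
    (1.18 : ℝ) * 106 = 125.08 ∧ (1.18 : ℝ) * 146.3 = 172.634 ∧
      (105.9 : ℝ) < 125 / 1.18 ∧ (125 : ℝ) / 1.18 < 106 := by
  norm_num

end

end Literature.MathematicalPhysics.QuantumLattice
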